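import Summits.HodgeConjecture.CorCM.Census.OcticWeilMultiDefect
import HarnessLib

/-!
# ANY NUMBER `r` of CM types over one octic CM field: the generating PARTS of a balanced configuration of `E × B₁ × ⋯ × B_r` —
# conjugate pairs, Weil FOURFOLD parts (`(2,2)`-slots), Weil SIXFOLD parts of `B_m × E × E` (`(1,3)`-slots), EIGHTFOLD parts of
# `B_m × B̄_{m'}`

COR-CM (cell `pub-hodgecm2`), seat b30 gen 24 (2026-08-22); count-neutral own lane OCTIC-MULTI (census half), part 3; sequel of
`Census/OcticWeilMulti{,Defect}.lean`.  Bookkeeping definitions (the part predicates) and theorems of a finite model; no named fact,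
no geometry, no `sorry`, no `decide`.  The four-pair twin of `Census/DecicWeil23MultiParts` generalising the parts of gens 18–21
(`IsWeilPart`, `IsWeil₃Part`, `IsSixfoldPart`, `IsEightfoldPart`) to arbitrary slots and positions.

THE PARTS of a configuration `(T, v)`, `v : α → PtO r`:
* `IsPairPartO v G` — two points over a conjugate pair of labels `{y, cjO y}` (a divisor weight);
* `IsFourPartO v m b G` — four points, one over each label `(m, a, b)`: for a `(2,2)`-slot the Weil weight of the fourfold `B_m`
  (balanced; Markman's fourfold theorem), for a `(1,3)`-slot a half of the next two;
* `IsSixPartO v m b G` — a four part of slot `m`, sign `b` plus TWO points over the curve label `inl b`: for a `(1,3)`-slot a lift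
  of the Weil weight of `B_m × E × E` (Markman's sixfold theorem, gen 18);
* `IsEightPartO v m m' G` — a four part `(m, +)` plus a four part `(m', −)`: the Weil weight of `B_m × B̄_{m'}` (gen 21's push-pull).

RESULTS (kernel).  Count functions (evaluated forms), splittings, selection of four and pair parts from the counts, and the balance of
the generating parts at every permutation `π` for positions of weights `w` (`IsPairPartO.balancedO`, `IsFourPartO.balancedO` for
`w m = 2`, `IsSixPartO.balancedO` for `w m = 1`, `IsEightPartO.balancedO` for `w m = w m'`), by the defect law
(`balancedO_of_defect`).  EXTRACTION and the INDUCTION PRINCIPLE are the sequel `Census/OcticWeilMultiExtraction.lean`.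
[cite: Pohlmann1968, Thm 1] [cite: GaoUllmo2025, Thm 3.1] [cite: Milne2020HodgeClassesAV, 1.2 (a) and Thm. 1]
[cite: MoonenZarhin1995Duke, Thm. 2.4] [cite: Gordon1999HodgeAVSurvey, 5.13 (ii), 9.2.2]

## References
* [Pohlmann1968] Ann. of Math. 88 (1968), Thm 1.  [GaoUllmo2025] J. Inst. Math. Jussieu 25 (2025), Thm 3.1.
  [Milne2020HodgeClassesAV] arXiv:2010.08857, 1.2 (a), Thm. 1.  [MoonenZarhin1995Duke] Duke Math. J. 77 (1995), Thm. 2.4.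
  [Gordon1999HodgeAVSurvey] CRM Monogr. 10 (1999), 5.13 (ii), 9.2.2.
-/

namespace Summit.HodgeConjecture.CorCM.Census.OcticWeilMulti

open Finset

variable {r : ℕ} {α : Type*} {P : Fin r → Fin 4 → Bool} {v : α → PtO r}

/-! ### The parts -/

/-- **A pair part**: two points over a conjugate pair of labels `{y, cjO y}` (a divisor weight, possibly spread over two copies).
[cite: Gordon1999HodgeAVSurvey, 9.2.2] -/
def IsPairPartO (v : α → PtO r) (G : Finset α) : Prop :=
  ∃ y : PtO r, G.card = 2 ∧ Set.InjOn v ↑G ∧ G.image v = {y, cjO y}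

/-- **A four part of slot `m` and sign `b`**: four points, one over each label `(m, a, b)` — the weight of the eigenline
`⋀⁴ H¹(B_m)_b`: the Weil weight of the fourfold `B_m` for a `(2,2)`-slot, a half of a sixfold or eightfold part for a `(1,3)`-slot.
[cite: MoonenZarhin1995Duke, Thm. 2.4] -/
def IsFourPartO (v : α → PtO r) (m : Fin r) (b : Bool) (G : Finset α) : Prop :=
  G.card = 4 ∧ ∀ a : Fin 4, (G.filter fun x => v x = Sum.inr (m, (a, b))).card = 1

/-- **A Weil SIXFOLD part of slot `m` and sign `b`** (for a `(1,3)`-slot): six points, TWO over the curve label `inl b` and one over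
each `(m, a, b)` — a lift of the Weil weight `2[τ_b] + Σ_a [(a, b)]` of `B_m × E × E` (`k`-signature `(3,3)`, gen 18's device).
[cite: MoonenZarhin1995Duke, Thm. 2.4]
[cite: Gordon1999HodgeAVSurvey, 5.13 (ii)] -/
def IsSixPartO (v : α → PtO r) (m : Fin r) (b : Bool) (G : Finset α) : Prop :=
  G.card = 6 ∧ (G.filter fun x => v x = Sum.inl b).card = 2 ∧ ∀ a : Fin 4, (G.filter fun x => v x = Sum.inr (m, (a, b))).card = 1

/-- **The Weil EIGHTFOLD part of the slots `(m, m')`**: eight points, one over each `(m, a, true)` and one over each `(m', a, false)` —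
a lift of the Weil weight of the eightfold `B_m × B̄_{m'}` (`k`-signature `(4,4)`). [cite: MoonenZarhin1995Duke, Thm. 2.4]
[cite: Gordon1999HodgeAVSurvey, 5.13 (ii)] -/
def IsEightPartO (v : α → PtO r) (m m' : Fin r) (G : Finset α) : Prop :=
  G.card = 8 ∧ (∀ a : Fin 4, (G.filter fun x => v x = Sum.inr (m, (a, true))).card = 1) ∧
    ∀ a : Fin 4, (G.filter fun x => v x = Sum.inr (m', (a, false))).card = 1

/-! ### Count functions -/

/-- The count function of a pair part: `1` on `y` and `cjO y`, `0` elsewhere. [folklore] -/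
theorem IsPairPartO.count_eq [DecidableEq α] {G : Finset α} (hG : IsPairPartO v G) : ∃ y : PtO r, ∀ z : PtO r,
    (G.filter fun x => v x = z).card = if z = y ∨ z = cjO y then 1 else 0 := by
  obtain ⟨y, hcard, hinj, himg⟩ := hG
  refine ⟨y, fun z => ?_⟩
  have hfib : ∀ z, (G.filter fun x => v x = z).card = if z ∈ G.image v then 1 else 0 := by
    intro z
    split_ifs with hz
    · obtain ⟨x, hx, rfl⟩ := Finset.mem_image.1 hz
      rw [Finset.card_eq_one]
      refine ⟨x, Finset.eq_singleton_iff_unique_mem.2 ⟨Finset.mem_filter.2 ⟨hx, rfl⟩, fun x' hx' => ?_⟩⟩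
      exact hinj (Finset.mem_of_mem_filter _ hx') hx (Finset.mem_filter.1 hx').2
    · rw [Finset.card_eq_zero, Finset.filter_eq_empty_iff]
      exact fun x hx hxz => hz (hxz ▸ Finset.mem_image_of_mem v hx)
  rw [hfib z, himg]
  simp only [Finset.mem_insert, Finset.mem_singleton]

/-- The fibres over pairwise distinct labels `f a` (`f` injective) and one further fibre fit into `G`. [folklore] -/
private theorem sum_fibres_add_le (G : Finset α) {f : Fin 4 → PtO r} (hf : Function.Injective f) {z : PtO r}
    (hz : ∀ a, z ≠ f a) :
    ∑ a : Fin 4, (G.filter fun x => v x = f a).card + (G.filter fun x => v x = z).card ≤ G.card := by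
  classical
  have hpd : ∀ a ∈ (univ : Finset (Fin 4)), ∀ a' ∈ (univ : Finset (Fin 4)), a ≠ a' →
      Disjoint (G.filter fun x => v x = f a) (G.filter fun x => v x = f a') :=
    fun a _ a' _ haa => Finset.disjoint_filter.2 fun x _ h1 h2 => haa (hf (h1.symm.trans h2))
  have hdisj : Disjoint ((univ : Finset (Fin 4)).biUnion fun a => G.filter fun x => v x = f a) (G.filter fun x => v x = z) :=
    (Finset.disjoint_biUnion_left _ _ _).2 fun a _ => Finset.disjoint_filter.2 fun x _ h1 h2 => hz a (h2.symm.trans h1)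
  rw [← Finset.card_biUnion hpd, ← Finset.card_union_of_disjoint hdisj]
  exact Finset.card_le_card (Finset.union_subset (Finset.biUnion_subset.2 fun a _ => Finset.filter_subset _ _)
    (Finset.filter_subset _ _))

/-- The labels `(m, a, b)`, `a < 5`, are pairwise distinct. [folklore] -/
theorem inr_injective (m : Fin r) (b : Bool) : Function.Injective fun a : Fin 4 => (Sum.inr (m, (a, b)) : PtO r) :=
  fun a a' h => by simpa using h

/-- The count function of a four part of slot `m`, sign `b`: `1` on the four `(m, a, b)`, `0` elsewhere. [folklore] -/
theorem IsFourPartO.count_eq {m : Fin r} {b : Bool} {G : Finset α} (hG : IsFourPartO v m b G) (z : PtO r) :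
    (G.filter fun x => v x = z).card = if ∃ a : Fin 4, z = Sum.inr (m, (a, b)) then 1 else 0 := by
  classical
  obtain ⟨hcard, hB⟩ := hG
  split_ifs with hz
  · obtain ⟨a, rfl⟩ := hz
    exact hB a
  · push Not at hz
    have hle := sum_fibres_add_le (v := v) G (inr_injective m b) hz
    simp only [hB, Finset.sum_const, Finset.card_univ, Fintype.card_fin, smul_eq_mul, mul_one, hcard] at hle
    omega

/-- The count function of a sixfold part: `2` on `inl b`, `1` on the four `(m, a, b)`, `0` elsewhere. [folklore] -/
theorem IsSixPartO.count_eq {m : Fin r} {b : Bool} {G : Finset α} (hG : IsSixPartO v m b G) (z : PtO r) :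
    (G.filter fun x => v x = z).card =
      if z = Sum.inl b then 2 else if ∃ a : Fin 4, z = Sum.inr (m, (a, b)) then 1 else 0 := by
  classical
  obtain ⟨hcard, hE, hB⟩ := hG
  split_ifs with hz hz'
  · rw [hz]; exact hE
  · obtain ⟨a, rfl⟩ := hz'; exact hB a
  · push Not at hz'
    have hle' : ∑ a : Fin 4, (G.filter fun x => v x = Sum.inr (m, (a, b))).card + (G.filter fun x => v x = z).card +
        (G.filter fun x => v x = Sum.inl b).card ≤ G.card := by
      have hpd : ∀ a ∈ (univ : Finset (Fin 4)), ∀ a' ∈ (univ : Finset (Fin 4)), a ≠ a' →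
          Disjoint (G.filter fun x => v x = Sum.inr (m, (a, b))) (G.filter fun x => v x = Sum.inr (m, (a', b))) :=
        fun a _ a' _ haa => Finset.disjoint_filter.2 fun x _ h1 h2 => haa (inr_injective m b (h1.symm.trans h2))
      have hd1 : Disjoint ((univ : Finset (Fin 4)).biUnion fun a => G.filter fun x => v x = Sum.inr (m, (a, b)))
          (G.filter fun x => v x = z) :=
        (Finset.disjoint_biUnion_left _ _ _).2 fun a _ => Finset.disjoint_filter.2 fun x _ h1 h2 => hz' a (h2.symm.trans h1)
      have hd2 : Disjoint (((univ : Finset (Fin 4)).biUnion fun a => G.filter fun x => v x = Sum.inr (m, (a, b))) ∪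
          (G.filter fun x => v x = z)) (G.filter fun x => v x = Sum.inl b) := by
        rw [Finset.disjoint_union_left]
        refine ⟨(Finset.disjoint_biUnion_left _ _ _).2 fun a _ => Finset.disjoint_filter.2 fun x _ h1 h2 => ?_,
          Finset.disjoint_filter.2 fun x _ h1 h2 => hz (h1.symm.trans h2)⟩
        rw [h1] at h2; exact Sum.inr_ne_inl h2
      rw [← Finset.card_biUnion hpd, ← Finset.card_union_of_disjoint hd1, ← Finset.card_union_of_disjoint hd2]
      exact Finset.card_le_card (Finset.union_subset (Finset.union_subset (Finset.biUnion_subset.2 fun a _ =>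
        Finset.filter_subset _ _) (Finset.filter_subset _ _)) (Finset.filter_subset _ _))
    simp only [hE, hB, Finset.sum_const, Finset.card_univ, Fintype.card_fin, smul_eq_mul, mul_one, hcard] at hle'
    omega

/-! ### Elementary properties of four parts -/

/-- Every point of a four part of slot `m`, sign `b` lies over a label `(m, a, b)`. [folklore] -/
theorem IsFourPartO.exists_eq_inr {m : Fin r} {b : Bool} {G : Finset α} (hG : IsFourPartO v m b G) {x : α} (hx : x ∈ G) :
    ∃ a : Fin 4, v x = Sum.inr (m, (a, b)) := by
  classical
  have hpos : 0 < (G.filter fun x' => v x' = v x).card := Finset.card_pos.2 ⟨x, Finset.mem_filter.2 ⟨hx, rfl⟩⟩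
  rw [hG.count_eq] at hpos
  by_contra h
  rw [if_neg h] at hpos
  exact lt_irrefl 0 hpos

/-- A pair part is non-empty. [folklore] -/
theorem IsPairPartO.nonempty {G : Finset α} (hG : IsPairPartO v G) : G.Nonempty := by
  obtain ⟨_, hcard, -⟩ := hG
  rw [← Finset.card_pos, hcard]; norm_num

/-- The model map is injective on a four part. [folklore] -/
theorem IsFourPartO.injOn {m : Fin r} {b : Bool} {G : Finset α} (hG : IsFourPartO v m b G) : Set.InjOn v ↑G := by
  classical
  intro x hx x' hx' h
  have hle : (G.filter fun y => v y = v x).card ≤ 1 := by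
    rw [hG.count_eq]; split_ifs <;> omega
  exact Finset.card_le_one.1 hle x (Finset.mem_filter.2 ⟨hx, rfl⟩) x' (Finset.mem_filter.2 ⟨hx', h.symm⟩)

/-- A four part is non-empty. [folklore] -/
theorem IsFourPartO.nonempty {m : Fin r} {b : Bool} {G : Finset α} (hG : IsFourPartO v m b G) : G.Nonempty := by
  rw [← Finset.card_pos, hG.1]; norm_num

/-- A four part inside `T` from the counts: one point over each `(m, a, b)`. [folklore] -/
theorem exists_fourPartO_of_counts [DecidableEq α] {T : Finset α} (m : Fin r) (b : Bool)
    (hB : ∀ a : Fin 4, 0 < (T.filter fun x => v x = Sum.inr (m, (a, b))).card) : ∃ G ⊆ T, IsFourPartO v m b G := by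
  have hpick : ∀ a : Fin 4, ∃ x ∈ T, v x = Sum.inr (m, (a, b)) := fun a => by
    obtain ⟨x, hx⟩ := Finset.card_pos.1 (hB a)
    exact ⟨x, (Finset.mem_filter.1 hx).1, (Finset.mem_filter.1 hx).2⟩
  choose pick hpickT hpickv using hpick
  have hpinj : Function.Injective pick := fun a a' h => by
    have e := hpickv a
    rw [h, hpickv a'] at e
    have : a' = a := by simpa using e
    exact this.symm
  refine ⟨univ.image pick, fun x hx => by obtain ⟨a, -, rfl⟩ := Finset.mem_image.1 hx; exact hpickT a, ?_, fun a => ?_⟩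
  · rw [Finset.card_image_of_injective _ hpinj, Finset.card_univ, Fintype.card_fin]
  · rw [Finset.card_eq_one]
    refine ⟨pick a, ?_⟩
    ext x
    simp only [Finset.mem_filter, Finset.mem_image, Finset.mem_univ, true_and, Finset.mem_singleton]
    constructor
    · rintro ⟨⟨a', rfl⟩, hvx⟩
      rw [hpickv a'] at hvx
      have : a' = a := by simpa using hvx
      rw [this]
    · rintro rfl
      exact ⟨⟨a, rfl⟩, hpickv a⟩

/-- A pair part inside `T` from the counts: one point over `y` and one over `cjO y`. [folklore] -/
theorem exists_pairPartO_of_counts [DecidableEq α] {T : Finset α} (y : PtO r)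
    (hy : 0 < (T.filter fun x => v x = y).card) (hcy : 0 < (T.filter fun x => v x = cjO y).card) :
    ∃ G ⊆ T, IsPairPartO v G := by
  obtain ⟨x, hx₀⟩ := Finset.card_pos.1 hy
  obtain ⟨hxT, hx⟩ := Finset.mem_filter.1 hx₀
  obtain ⟨x', hx₀'⟩ := Finset.card_pos.1 hcy
  obtain ⟨hx'T, hx'⟩ := Finset.mem_filter.1 hx₀'
  have hne : x ≠ x' := by
    intro h
    apply cjO_ne y
    rw [← hx', ← h, hx]
  refine ⟨{x, x'}, ?_, y, Finset.card_pair hne, ?_, ?_⟩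
  · intro z hz
    rcases Finset.mem_insert.1 hz with rfl | hz
    · exact hxT
    · rw [Finset.mem_singleton.1 hz]; exact hx'T
  · intro z hz z' hz' hzz'
    simp only [Finset.coe_insert, Finset.coe_singleton, Set.mem_insert_iff, Set.mem_singleton_iff] at hz hz'
    rcases hz with rfl | rfl <;> rcases hz' with rfl | rfl
    · rfl
    · exfalso; rw [hx, hx'] at hzz'; exact cjO_ne y hzz'.symm
    · exfalso; rw [hx, hx'] at hzz'; exact cjO_ne y hzz'
    · rfl
  · rw [Finset.image_insert, Finset.image_singleton, hx, hx']

/-! ### Splitting the sixfold and eightfold parts -/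

/-- An eightfold part is two four parts: slot `m`, sign `true` and slot `m'`, sign `false`. [folklore] -/
theorem IsEightPartO.exists_split [DecidableEq α] {m m' : Fin r} {G : Finset α} (hG : IsEightPartO v m m' G) :
    ∃ G₀ G₁ : Finset α, Disjoint G₀ G₁ ∧ G = G₀ ∪ G₁ ∧ IsFourPartO v m true G₀ ∧ IsFourPartO v m' false G₁ := by
  obtain ⟨W₀, hW₀, hW₀'⟩ := exists_fourPartO_of_counts (v := v) (T := G) m true fun a => by rw [hG.2.1 a]; exact one_pos
  obtain ⟨W₁, hW₁, hW₁'⟩ := exists_fourPartO_of_counts (v := v) (T := G) m' false fun a => by rw [hG.2.2 a]; exact one_pos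
  have hW : Disjoint W₀ W₁ := by
    rw [Finset.disjoint_left]
    intro x hx0 hx1
    obtain ⟨a, ha⟩ := hW₀'.exists_eq_inr hx0
    obtain ⟨a', ha'⟩ := hW₁'.exists_eq_inr hx1
    have := ha.symm.trans ha'
    simp at this
  refine ⟨W₀, W₁, hW, ?_, hW₀', hW₁'⟩
  symm
  apply Finset.eq_of_subset_of_card_le (Finset.union_subset hW₀ hW₁)
  rw [Finset.card_union_of_disjoint hW, hW₀'.1, hW₁'.1, hG.1]

/-- The count function of an eightfold part: `1` on the four `(m, a, true)` and the four `(m', a, false)`, `0` elsewhere. [folklore] -/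
theorem IsEightPartO.count_eq [DecidableEq α] {m m' : Fin r} {G : Finset α} (hG : IsEightPartO v m m' G) (z : PtO r) :
    (G.filter fun x => v x = z).card =
      if (∃ a : Fin 4, z = Sum.inr (m, (a, true))) ∨ ∃ a : Fin 4, z = Sum.inr (m', (a, false)) then 1 else 0 := by
  obtain ⟨G₀, G₁, hd, rfl, h₀, h₁⟩ := hG.exists_split
  rw [Finset.filter_union, Finset.card_union_of_disjoint (Finset.disjoint_filter_filter hd), h₀.count_eq, h₁.count_eq]
  by_cases hz0 : ∃ a : Fin 4, z = Sum.inr (m, (a, true))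
  · have hz1 : ¬ ∃ a : Fin 4, z = Sum.inr (m', (a, false)) := fun ⟨a, ha⟩ => by
      obtain ⟨a', ha'⟩ := hz0; rw [ha'] at ha; simp at ha
    rw [if_pos hz0, if_neg hz1, if_pos (Or.inl hz0)]
  · by_cases hz1 : ∃ a : Fin 4, z = Sum.inr (m', (a, false))
    · rw [if_neg hz0, if_pos hz1, if_pos (Or.inr hz1)]
    · rw [if_neg hz0, if_neg hz1, if_neg (fun h => h.elim hz0 hz1)]

/-! ### The count functions in evaluated form -/

/-- A four part: no point over the curve labels. [folklore] -/
theorem IsFourPartO.card_filter_inl {m : Fin r} {b : Bool} {G : Finset α} (hG : IsFourPartO v m b G) (b' : Bool) :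
    (G.filter fun x => v x = Sum.inl b').card = 0 := by
  classical
  rw [hG.count_eq, if_neg]
  rintro ⟨a, ha⟩
  exact Sum.inl_ne_inr ha

/-- A four part: one point over `(m, a, b)`, none over the other fourfold labels. [folklore] -/
theorem IsFourPartO.card_filter_inr {m : Fin r} {b : Bool} {G : Finset α} (hG : IsFourPartO v m b G) (m' : Fin r) (a : Fin 4)
    (b' : Bool) : (G.filter fun x => v x = Sum.inr (m', (a, b'))).card = if m' = m ∧ b' = b then 1 else 0 := by
  classical
  rw [hG.count_eq]
  by_cases h : m' = m ∧ b' = b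
  · obtain ⟨rfl, rfl⟩ := h
    rw [if_pos ⟨a, rfl⟩, if_pos ⟨rfl, rfl⟩]
  · rw [if_neg h, if_neg]
    rintro ⟨a', ha'⟩
    simp only [Sum.inr.injEq, Prod.mk.injEq] at ha'
    exact h ⟨ha'.1, ha'.2.2⟩

/-- A sixfold part is two curve points plus a four part, at the level of counts: `G₁ = {x ∈ G | v x ≠ inl b}` is a four part and
`#{x ∈ G | v x = z} = 2·[z = inl b] + #{x ∈ G₁ | v x = z}`. [folklore] -/
theorem IsSixPartO.card_filter_eq [DecidableEq α] {m : Fin r} {b : Bool} {G : Finset α} (hG : IsSixPartO v m b G) :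
    ∃ G₁ ⊆ G, IsFourPartO v m b G₁ ∧ ∀ z : PtO r,
      (G.filter fun x => v x = z).card = (if z = Sum.inl b then 2 else 0) + (G₁.filter fun x => v x = z).card := by
  refine ⟨G.filter fun x => ¬ v x = Sum.inl b, Finset.filter_subset _ _, ⟨?_, fun a => ?_⟩, fun z => ?_⟩
  · have h := Finset.card_filter_add_card_filter_not (s := G) (fun x => v x = Sum.inl b)
    rw [hG.2.1, hG.1] at h
    omega
  · rw [Finset.filter_filter, ← hG.2.2 a]
    congr 1
    exact Finset.filter_congr fun x _ => ⟨fun h => h.2, fun h => ⟨by rw [h]; exact Sum.inr_ne_inl, h⟩⟩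
  · rw [Finset.filter_filter]
    by_cases hz : z = Sum.inl b
    · rw [if_pos hz, hz, hG.2.1, Finset.filter_false_of_mem (fun x _ h => h.1 h.2), Finset.card_empty]
    · rw [if_neg hz, zero_add]
      congr 1
      exact Finset.filter_congr fun x _ => ⟨fun h => ⟨by rw [h]; exact hz, h⟩, fun h => h.2⟩

/-! ### The parts are balanced at every permutation -/

section Balanced

variable (P) (w : Fin r → ℕ) (hP : ∀ m, ((univ : Finset (Fin 4)).filter fun a => P m a = true).card = w m)

include hP in
/-- **A pair part is balanced** (its count function is conjugation-invariant, so all defects vanish).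
[cite: Gordon1999HodgeAVSurvey, 9.2.2] -/
theorem IsPairPartO.balancedO [DecidableEq α] {G : Finset α} (hG : IsPairPartO v G) (π : Equiv.Perm (Fin 4)) :
    2 * (G.filter fun x => v x ∈ phiO P π).card = G.card := by
  obtain ⟨y, hy⟩ := hG.count_eq
  have hsymm : ∀ z : PtO r, (G.filter fun x => v x = cjO z).card = (G.filter fun x => v x = z).card := by
    intro z
    rw [hy, hy]
    have h1 : cjO z = y ↔ z = cjO y := ⟨fun h => by rw [← h, cjO_cjO], fun h => by rw [h, cjO_cjO]⟩
    have h2 : cjO z = cjO y ↔ z = y := ⟨fun h => by rw [← cjO_cjO z, h, cjO_cjO], fun h => by rw [h]⟩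
    simp only [h1, h2, or_comm]
  refine balancedO_of_defect (P := P) (v := v) w hP π (fun _ => 0) (fun m a => ?_) ?_
  · have h := hsymm (Sum.inr (m, (a, true)))
    rw [cjO_inr, Bool.not_true] at h
    rw [h, sub_self]
  · have h := hsymm (Sum.inl true)
    rw [cjO_inl, Bool.not_true] at h
    rw [h, sub_self]
    exact (Finset.sum_eq_zero fun m _ => by rw [mul_zero]).symm

include hP in
/-- **A four part of a `(2,2)`-slot is balanced** (defects `t_{m'} = ±[m' = m]`, curve coefficient `4 − 2·2 = 0`: the Weil class of the
fourfold `B_m` is a Hodge class for every conjugate type). [cite: MoonenZarhin1995Duke, Thm. 2.4] -/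
theorem IsFourPartO.balancedO [DecidableEq α] {m : Fin r} {b : Bool} {G : Finset α} (hG : IsFourPartO v m b G) (hm : w m = 2)
    (π : Equiv.Perm (Fin 4)) : 2 * (G.filter fun x => v x ∈ phiO P π).card = G.card := by
  refine balancedO_of_defect (P := P) (v := v) w hP π (fun m' => if m' = m then (if b then 1 else -1) else 0) (fun m' a => ?_) ?_
  · rw [hG.card_filter_inr, hG.card_filter_inr]
    by_cases hm' : m' = m
    · rw [if_pos hm']; cases b <;> simp [hm']
    · rw [if_neg hm']; simp [hm']
  · rw [hG.card_filter_inl, hG.card_filter_inl, Finset.sum_congr rfl fun m' _ => show (4 - 2 * (w m' : ℤ)) *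
      (if m' = m then (if b then 1 else -1) else 0) = if m' = m then (4 - 2 * (w m : ℤ)) * (if b then 1 else -1) else 0 by
        split_ifs with h <;> simp [h], Finset.sum_ite_eq' Finset.univ m, if_pos (Finset.mem_univ m), hm]
    simp

include hP in
/-- **A sixfold part of a `(1,3)`-slot is balanced** (defects `t_{m'} = ±[m' = m]`, curve defect `±2 = (4 − 2·1)·(±1)`: the Weil class of
`B_m × E × E`). [cite: MoonenZarhin1995Duke, Thm. 2.4] -/
theorem IsSixPartO.balancedO [DecidableEq α] {m : Fin r} {b : Bool} {G : Finset α} (hG : IsSixPartO v m b G) (hm : w m = 1)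
    (π : Equiv.Perm (Fin 4)) : 2 * (G.filter fun x => v x ∈ phiO P π).card = G.card := by
  obtain ⟨G₁, -, hG₁, hcount⟩ := hG.card_filter_eq
  refine balancedO_of_defect (P := P) (v := v) w hP π (fun m' => if m' = m then (if b then 1 else -1) else 0) (fun m' a => ?_) ?_
  · rw [hcount, hcount, hG₁.card_filter_inr, hG₁.card_filter_inr, if_neg Sum.inr_ne_inl, if_neg Sum.inr_ne_inl]
    by_cases hm' : m' = m
    · rw [if_pos hm']; cases b <;> simp [hm']
    · rw [if_neg hm']; simp [hm']
  · rw [hcount, hcount, hG₁.card_filter_inl, hG₁.card_filter_inl, Finset.sum_congr rfl fun m' _ => show (4 - 2 * (w m' : ℤ)) *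
      (if m' = m then (if b then 1 else -1) else 0) = if m' = m then (4 - 2 * (w m : ℤ)) * (if b then 1 else -1) else 0 by
        split_ifs with h <;> simp [h], Finset.sum_ite_eq' Finset.univ m, if_pos (Finset.mem_univ m), hm]
    cases b <;> simp

include hP in
/-- **An eightfold part of two slots of the same weight is balanced** (defects `t = [· = m] − [· = m']`, `e = 0`: the Weil class of
`B_m × B̄_{m'}`). [cite: MoonenZarhin1995Duke, Thm. 2.4] -/
theorem IsEightPartO.balancedO [DecidableEq α] {m m' : Fin r} {G : Finset α} (hG : IsEightPartO v m m' G) (hmm : w m = w m')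
    (π : Equiv.Perm (Fin 4)) : 2 * (G.filter fun x => v x ∈ phiO P π).card = G.card := by
  obtain ⟨G₀, G₁, hd, rfl, h₀, h₁⟩ := hG.exists_split
  have hcount : ∀ z : PtO r, ((G₀ ∪ G₁).filter fun x => v x = z).card =
      (G₀.filter fun x => v x = z).card + (G₁.filter fun x => v x = z).card := fun z => by
    rw [Finset.filter_union, Finset.card_union_of_disjoint (Finset.disjoint_filter_filter hd)]
  refine balancedO_of_defect (P := P) (v := v) w hP π (fun l => (if l = m then 1 else 0) - (if l = m' then 1 else 0))
    (fun l a => ?_) ?_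
  · rw [hcount, hcount, h₀.card_filter_inr, h₀.card_filter_inr, h₁.card_filter_inr, h₁.card_filter_inr]
    by_cases hl : l = m <;> by_cases hl' : l = m' <;> simp [hl, hl']
  · rw [hcount, hcount, h₀.card_filter_inl, h₀.card_filter_inl, h₁.card_filter_inl, h₁.card_filter_inl,
      Finset.sum_congr rfl fun l _ => show (4 - 2 * (w l : ℤ)) * ((if l = m then 1 else 0) - (if l = m' then 1 else 0)) =
        (if l = m then (4 - 2 * (w l : ℤ)) else 0) - (if l = m' then (4 - 2 * (w l : ℤ)) else 0) by
        split_ifs <;> simp, Finset.sum_sub_distrib,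
      Finset.sum_ite_eq' Finset.univ m (fun l => 4 - 2 * (w l : ℤ)), Finset.sum_ite_eq' Finset.univ m' (fun l => 4 - 2 * (w l : ℤ)),
      if_pos (Finset.mem_univ _), if_pos (Finset.mem_univ _), hmm]
    simp

end Balanced

end Summit.HodgeConjecture.CorCM.Census.OcticWeilMulti
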